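import Summits.ResolutionOfSingularities.ResolutionOfSingularities.Theorems.FrobeniusLadderFInjectiveMacaulayficationS2ModificationAffineLocal
import Literature.RingTheory.IntegralClosure.KrullIntersection
import Literature.RingTheory.KrullDimension.AffineDimension
import Literature.AlgebraicGeometry.Resolution.NormalAscent
import Mathlib.RingTheory.Ideal.KrullsHeightTheorem
import Mathlib.RingTheory.Ideal.GoingUp
import HarnessLib

/-!
# The affine S₂-modification algebra — file L3b: the localised normalisation `Ā_P` and the Cohen–Macaulay clause of `A′_P`
# in dimension 2
# (crux `FInjectiveMacaulayfication` stmt-ResolutionOfSingularities-15315, chain w45a, hole #3γ, FC′ rung r2 input S-S2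
# `FCForallExistsDimLe2.S2Modification`; res-L1-w45a-plan-1 R14.1 (5) «stub-3 := S2ModificationAffine L3»; construction =
# res-L1-w45a-stub-7's memo `D/res-D-pv-019/S2MOD-MEMO.md` §2 (c); seat res-L1-w45a-stub-3)

[OURS · L1 W4.5a] Support file (`--supports stmt-ResolutionOfSingularities-15315 --as helper`); NOT a statement of any manuscript;
no named fact; AI-written (AI review is weaker than expert review).

SETTING (files `…S2ModificationAffine`, `…S2ModificationAffineLocal`): `A` a Noetherian domain with fraction field `K`, `s` a
finite set of non-zero elements, `A′ = s2Mod A K s hs = Ā ∩ ⋂_{f ∈ s} A[1/f]`, `P ⊇ s` a prime of `A′` (a point over `V(𝔟)`),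
`A′_P = locSub A K s hs P ⊆ K`.

* §1 `normLoc` — the localised normalisation `Ā_P := Ā[(A′ ∖ P)⁻¹] ⊆ K` (memo §2 (c)'s semilocal normal ring `B ⊗ (𝒜_x)_{𝔪′}`):
  a localisation of `Ā`, hence Noetherian and normal when `Ā` is finite over `A`; `A′_P ⊆ Ā_P`; `Ā` is integral over `A′`.
* §2 THE DIMENSION-2 ARGUMENT (memo §2 (c)). Let `dim A′_P = 2`, `a, b ∈ A′_P` a system of parameters (`√(a, b) = 𝔪`), `a ≠ 0`,
  `b c = a d`; put `z = c/a ∈ K`.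
  (c-1) `div_mem_normLoc`: `z ∈ Ā_P` — by Krull's intersection theorem for the Noetherian normal domain `Ā_P`
  (`Literature.RingTheory.IntegralClosure.exists_algebraMap_eq_of_forall_height_eq_one`): at a height-one prime `𝔔` of `Ā_P`
  one of `a, b` is a unit (`a z = c`, `b z = d`), because `a, b ∈ 𝔔` would make `𝔔 ∩ A′ = P` maximal, hence `𝔔 ∩ Ā` a maximal
  ideal of `Ā` of height `dim A = 2` (EQUIDIMENSIONALITY of the affine domain `Ā`, hypothesis `hequi`), while localisation
  preserves heights (`ht = 1`);
  (c-2) `exists_mul_div_mem_awaySub`: for `f ∈ s`, `fⁿ ∈ (a, b)` gives `fⁿ z ∈ A′_P`, so `t z ∈ A[1/f]` for some `t ∉ P` — free;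
  (c-3) `div_mem_locSub`: hence `t z ∈ Ā ∩ ⋂ A[1/f] = A′` for a product `t ∉ P`, i.e. `z ∈ A′_P` and `c ∈ a A′_P`;
  `cmClause_locSub_of_eq_two`: so `a, b` is a weakly regular sequence (`a ≠ 0` by Krull's principal ideal theorem), i.e. the
  crux's `NonFullLocusClosed.CMClause` holds for `A′_P`.
The assembly (all primes `P ⊇ s`, transport to `Localization.AtPrime P`, discharge of finiteness/equidimensionality for affine
domains) is file L3c `…S2ModificationAffineClauses`. NO hypothesis on `A` off `V(𝔟)` is used.
[folklore; cite: EGAIV2, 5.10.16–17; Matsumura1987, Thm. 11.5 and Thm. 5.6]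
-/

-- single-problem summit: the doubled namespace component is forced
set_option linter.dupNamespace false

noncomputable section

namespace Summit.ResolutionOfSingularities.ResolutionOfSingularities.Theorems.FInjectiveMacaulayfication.S2ModificationAffineDimTwo

open Summit.ResolutionOfSingularities.ResolutionOfSingularities.Theorems.FInjectiveMacaulayfication
open S2ModificationAffine S2ModificationAffineLocal nonZeroDivisors IsLocalRing

variable (A : Type) [CommRing A] [IsDomain A] (K : Type) [Field K] [Algebra A K] [IsFractionRing A K]
variable (s : Finset A) (hs : ∀ f ∈ s, f ≠ 0)

/-! ## §1 The localised normalisation `Ā_P ⊆ K` (memo §2 (c): the semilocal normal ring `B ⊗ (𝒜_x)_{𝔪'}`) -/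

/-- The inclusion `A′ ↪ Ā` as an `A`-algebra map. [folklore] -/
def toNormalization : s2Mod A K s hs →ₐ[A] integralClosure A K :=
  Subalgebra.inclusion (s2Mod_le_integralClosure A K s hs)

/-- The image `T₁ ⊆ Ā` of the multiplicative set `A′ ∖ P`. [folklore] -/
def primeComplImage (P : Ideal (s2Mod A K s hs)) [P.IsPrime] : Submonoid (integralClosure A K) :=
  P.primeCompl.map (toNormalization A K s hs)

/-- `T₁` consists of non-zero-divisors of the domain `Ā`. [folklore] -/
theorem primeComplImage_le (P : Ideal (s2Mod A K s hs)) [P.IsPrime] :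
    primeComplImage A K s hs P ≤ (integralClosure A K)⁰ := by
  intro y hy
  obtain ⟨t, ht, rfl⟩ := Submonoid.mem_map.mp hy
  refine mem_nonZeroDivisors_of_ne_zero fun h => ?_
  have h' : (t : K) = 0 := congrArg (fun z : integralClosure A K => (z : K)) h
  exact coe_ne_zero_of_not_mem A K s hs P (Ideal.mem_primeCompl_iff.mp ht) h'

/-- **The localised normalisation `Ā_P := Ā[(A′ ∖ P)⁻¹] ⊆ K`** — a Noetherian normal domain with fraction field `K`
when `Ā` is Noetherian (memo §2 (c)'s «semilocal NORMAL ring `B ⊗ (𝒜_x)_{𝔪'}`»). [folklore] -/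
def normLoc (P : Ideal (s2Mod A K s hs)) [P.IsPrime] : Subalgebra (integralClosure A K) K :=
  Localization.subalgebra.ofField K (primeComplImage A K s hs P) (primeComplImage_le A K s hs P)

/-- `Ā_P ⊆ K` is a localisation of `Ā` at `T₁`. [folklore] -/
instance isLocalization_normLoc (P : Ideal (s2Mod A K s hs)) [P.IsPrime] :
    IsLocalization (primeComplImage A K s hs P) (normLoc A K s hs P) :=
  Localization.subalgebra.isLocalization_ofField K _ _

/-- Membership in `Ā_P`: `x = y · t⁻¹` with `y ∈ Ā` and `t ∈ A′ ∖ P`. [folklore] -/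
theorem mem_normLoc_iff (P : Ideal (s2Mod A K s hs)) [P.IsPrime] (x : K) :
    x ∈ normLoc A K s hs P ↔ ∃ (y : integralClosure A K) (t : s2Mod A K s hs), t ∉ P ∧ x = (y : K) * ((t : K))⁻¹ := by
  unfold normLoc Localization.subalgebra.ofField
  rw [← SetLike.mem_coe, Subalgebra.coe_copy]
  simp only [Set.mem_setOf_eq]
  constructor
  · rintro ⟨y, t₁, ht₁, rfl⟩
    obtain ⟨t, ht, rfl⟩ := Submonoid.mem_map.mp ht₁
    exact ⟨y, t, Ideal.mem_primeCompl_iff.mp ht, rfl⟩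
  · rintro ⟨y, t, ht, rfl⟩
    exact ⟨y, toNormalization A K s hs t, Submonoid.mem_map.mpr ⟨t, Ideal.mem_primeCompl_iff.mpr ht, rfl⟩, rfl⟩

/-- `A′_P ⊆ Ā_P` inside `K`. [folklore] -/
theorem locSub_le_normLoc (P : Ideal (s2Mod A K s hs)) [P.IsPrime] {x : K} (hx : x ∈ locSub A K s hs P) :
    x ∈ normLoc A K s hs P := by
  obtain ⟨b, t, ht, rfl⟩ := (mem_locSub_iff A K s hs P x).mp hx
  exact (mem_normLoc_iff A K s hs P _).mpr ⟨toNormalization A K s hs b, t, ht, rfl⟩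

/-- The inclusion `A′_P ↪ Ā_P` as a ring map. [folklore] -/
def locSubToNormLoc (P : Ideal (s2Mod A K s hs)) [P.IsPrime] : locSub A K s hs P →+* normLoc A K s hs P where
  toFun x := ⟨x.1, locSub_le_normLoc A K s hs P x.2⟩
  map_one' := Subtype.ext rfl
  map_mul' _ _ := Subtype.ext rfl
  map_zero' := Subtype.ext rfl
  map_add' _ _ := Subtype.ext rfl

/-- `Ā` is integral over `A′` along the inclusion. [folklore] -/
theorem isIntegral_toNormalization : (toNormalization A K s hs).toRingHom.IsIntegral := by
  intro y
  have hy : IsIntegral A y :=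
    (isIntegral_algHom_iff (integralClosure A K).val Subtype.val_injective).mp y.2
  obtain ⟨p, hp, hpy⟩ := hy
  refine ⟨p.map (algebraMap A (s2Mod A K s hs)), hp.map _, ?_⟩
  rw [Polynomial.eval₂_map, AlgHom.toRingHom_eq_coe, AlgHom.comp_algebraMap]
  exact hpy


/-! ## §2 The dimension-2 Cohen–Macaulay argument (memo §2 (c)) -/

section DimTwo

variable (P : Ideal (s2Mod A K s hs)) [P.IsPrime]

/-- Coercion to `K` of a product in `A′_P`. [folklore] -/
theorem coe_mul_locSub (x y : locSub A K s hs P) : ((x * y : locSub A K s hs P) : K) = (x : K) * (y : K) := rfl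

/-- **Step (c-1): `z = c/a ∈ Ā_P`** (Krull's intersection theorem `Ā_P = ⋂_{ht 𝔔 = 1} (Ā_P)_𝔔` for the Noetherian normal
domain `Ā_P`). Let `a, b ∈ A′_P` with `P·A′_P ⊆ √(a, b)`, `a ≠ 0`, `b c = a d`. For a height-one prime `𝔔` of `Ā_P`: if `a ∉ 𝔔`
then `a · z = c`; if `b ∉ 𝔔` then `b · z = d`; and `a, b ∈ 𝔔` is impossible — then `𝔔 ∩ A′ = P` is MAXIMAL, so `𝔔 ∩ Ā` is a
maximal ideal of the affine domain `Ā` (integral over `A′`), of height `dim A = 2` (equidimensionality, hypothesis `hequi`),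
while localisation preserves heights: `ht (𝔔 ∩ Ā) = ht 𝔔 = 1`. [folklore; cite: EGAIV2, 5.10.16–17] -/
theorem div_mem_normLoc [IsNoetherianRing A] (hfin : Module.Finite A (integralClosure A K))
    (hequi : ∀ Q : Ideal (integralClosure A K), Q.IsMaximal → (Q.height : WithBot ℕ∞) = ringKrullDim A)
    (hdimA : ringKrullDim A = (2 : ℕ)) (hPmax : P.IsMaximal)
    {a b c d : locSub A K s hs P} (hrel : b * c = a * d) (ha : a ≠ 0)
    (hPab : ∀ x ∈ P, algebraMap (s2Mod A K s hs) (locSub A K s hs P) x ∈ (Ideal.span {a, b}).radical) :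
    (c : K) / (a : K) ∈ normLoc A K s hs P := by
  haveI : Module.Finite A (integralClosure A K) := hfin
  haveI : IsNoetherianRing (integralClosure A K) := IsNoetherianRing.of_finite A _
  haveI : IsNoetherianRing (normLoc A K s hs P) := IsLocalization.isNoetherianRing (primeComplImage A K s hs P) (normLoc A K s hs P) inferInstance
  haveI : IsIntegrallyClosed (integralClosure A K) :=
    integralClosure.isIntegrallyClosedOfFiniteExtension (R := A) K (L := K)
  haveI : IsIntegrallyClosed (normLoc A K s hs P) :=
    isIntegrallyClosed_of_isLocalization (normLoc A K s hs P) (primeComplImage A K s hs P) (primeComplImage_le A K s hs P)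
  haveI : IsFractionRing (normLoc A K s hs P) K := Localization.subalgebra.isFractionRing_ofField K _ _
  have haK : (a : K) ≠ 0 := fun h => ha (Subtype.ext h)
  have hrelK : (b : K) * (c : K) = (a : K) * (d : K) := by
    have := congrArg (fun z : locSub A K s hs P => (z : K)) hrel
    simpa only [coe_mul_locSub] using this
  let j := locSubToNormLoc A K s hs P
  suffices key : ∀ Q : Ideal (normLoc A K s hs P), Q.IsPrime → Q.height = 1 →
      ∃ σ ∉ Q, ∃ r : normLoc A K s hs P,
        algebraMap (normLoc A K s hs P) K σ * ((c : K) / (a : K)) = algebraMap (normLoc A K s hs P) K r by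
    obtain ⟨y, hy⟩ := Literature.RingTheory.IntegralClosure.exists_algebraMap_eq_of_forall_height_eq_one
      (R := (normLoc A K s hs P)) (K := K) ((c : K) / (a : K)) key
    rw [← hy]
    exact y.2
  intro Q hQ hQ1
  by_cases haQ : j a ∈ Q
  · by_cases hbQ : j b ∈ Q
    · exfalso
      -- the contraction `𝔔 ∩ Ā` and its height
      set Q₀ : Ideal (integralClosure A K) := Q.comap (algebraMap (integralClosure A K) (normLoc A K s hs P)) with hQ₀def
      haveI : Q₀.IsPrime := hQ.comap _
      have hQ₀ : Q₀.height = 1 := by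
        rw [← hQ1]
        exact IsLocalization.height_under (primeComplImage A K s hs P) Q
      -- `𝔔 ∩ A′ = P`
      have hQB : Q₀.comap (toNormalization A K s hs).toRingHom = P := by
        apply le_antisymm
        · intro x hx
          by_contra hxP
          have hxT : toNormalization A K s hs x ∈ primeComplImage A K s hs P :=
            Submonoid.mem_map.mpr ⟨x, Ideal.mem_primeCompl_iff.mpr hxP, rfl⟩
          have hu : IsUnit (algebraMap (integralClosure A K) (normLoc A K s hs P) (toNormalization A K s hs x)) :=
            IsLocalization.map_units (M := primeComplImage A K s hs P) (normLoc A K s hs P) ⟨_, hxT⟩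
          exact hQ.ne_top (Ideal.eq_top_of_isUnit_mem Q (Ideal.mem_comap.mp (Ideal.mem_comap.mp hx)) hu)
        · intro x hx
          obtain ⟨n, hn⟩ := hPab x hx
          have hle : Ideal.span {a, b} ≤ Q.comap j := by
            rw [Ideal.span_le]
            intro w hw
            rcases hw with rfl | hw
            · exact haQ
            · rw [Set.mem_singleton_iff] at hw
              subst hw
              exact hbQ
          have h2 : algebraMap _ (locSub A K s hs P) x ∈ Q.comap j := (hQ.comap j).mem_of_pow_mem n (hle hn)
          have h3 : j (algebraMap _ (locSub A K s hs P) x) = algebraMap (integralClosure A K) (normLoc A K s hs P) (toNormalization A K s hs x) :=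
            Subtype.ext rfl
          have h4 : j (algebraMap _ (locSub A K s hs P) x) ∈ Q := Ideal.mem_comap.mp h2
          rw [h3] at h4
          exact Ideal.mem_comap.mpr (Ideal.mem_comap.mpr h4)
      have hQ₀max : Q₀.IsMaximal :=
        Ideal.isMaximal_of_isIntegral_of_isMaximal_comap' (toNormalization A K s hs).toRingHom
          (isIntegral_toNormalization A K s hs) Q₀ (by rw [hQB]; exact hPmax)
      have h := hequi Q₀ hQ₀max
      rw [hQ₀, hdimA] at h
      norm_num at h
    · refine ⟨j b, hbQ, j d, ?_⟩
      change (b : K) * ((c : K) / (a : K)) = (d : K)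
      rw [mul_div_assoc', hrelK]
      exact mul_div_cancel_left₀ _ haK
  · refine ⟨j a, haQ, j c, ?_⟩
    change (a : K) * ((c : K) / (a : K)) = (c : K)
    exact mul_div_cancel₀ _ haK


/-- **Step (c-2): `z = c/a ∈ A[1/f]` up to a unit of `A′_P`, for every `f ∈ s` with `f ∈ P`** — no Krull needed: `f ∈ P A′_P ⊆
√(a, b)` gives `fⁿ = α a + β b`, so `fⁿ z = α c + β d ∈ A′_P`, i.e. `t · z ∈ A′[1/f] ⊆ A[1/f]` for some `t ∉ P`. [folklore] -/
theorem exists_mul_div_mem_awaySub {a b c d : locSub A K s hs P} (hrel : b * c = a * d) (ha : a ≠ 0)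
    (hPab : ∀ x ∈ P, algebraMap (s2Mod A K s hs) (locSub A K s hs P) x ∈ (Ideal.span {a, b}).radical)
    (f : A) (hf : f ∈ s) (hfP : algebraMap A (s2Mod A K s hs) f ∈ P) :
    ∃ t : s2Mod A K s hs, t ∉ P ∧ (t : K) * ((c : K) / (a : K)) ∈ awaySub A K f (hs f hf) := by
  obtain ⟨n, hn⟩ := hPab _ hfP
  obtain ⟨α, β, hαβ⟩ := Ideal.mem_span_pair.mp hn
  obtain ⟨b₀, t, ht, heq⟩ := (mem_locSub_iff A K s hs P _).mp (α * c + β * d).2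
  refine ⟨t, ht, ?_⟩
  have hfK : algebraMap A K f ≠ 0 :=
    fun h => hs f hf ((injective_iff_map_eq_zero (algebraMap A K)).mp (IsFractionRing.injective A K) f h)
  have haK : (a : K) ≠ 0 := fun h => ha (Subtype.ext h)
  have htK : (t : K) ≠ 0 := coe_ne_zero_of_not_mem A K s hs P ht
  have hrelK : (b : K) * (c : K) = (a : K) * (d : K) := by
    have := congrArg (fun z : locSub A K s hs P => (z : K)) hrel
    simpa only [coe_mul_locSub] using this
  have h1 : (algebraMap A K f) ^ n = (α : K) * (a : K) + (β : K) * (b : K) := by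
    have := congrArg (fun z : locSub A K s hs P => (z : K)) hαβ
    simp only [coe_mul_locSub, Subalgebra.coe_add, Subalgebra.coe_pow] at this
    exact this.symm
  have h2 : ((α : K) * (c : K) + (β : K) * (d : K)) * (t : K) = (b₀ : K) := by
    have h2' : (((α * c + β * d : locSub A K s hs P)) : K) = (b₀ : K) * ((t : K))⁻¹ := heq
    simp only [coe_mul_locSub, Subalgebra.coe_add] at h2'
    rw [h2', mul_assoc, inv_mul_cancel₀ htK, mul_one]
  have h3 : (t : K) * ((c : K) / (a : K)) = (b₀ : K) * (algebraMap A K (f ^ n))⁻¹ := by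
    rw [map_pow, eq_mul_inv_iff_mul_eq₀ (pow_ne_zero n hfK), h1]
    field_simp
    linear_combination (a : K) * h2 + (β : K) * (t : K) * hrelK
  rw [h3]
  exact Subalgebra.mul_mem _ (s2Mod_le_awaySub A K s hs f hf b₀.2)
    ((mem_awaySub_iff A K f (hs f hf) _).mpr ⟨1, n, by rw [map_one, one_mul]⟩)

/-- **Step (c-3) = memo §2 (c): `z = c/a ∈ A′_P`.** For a prime `P ⊇ s` of `A′` with `dim A′_P = 2` (so `dim A = dim A′ = 2`
and `P` is maximal), `a, b ∈ A′_P` with `√(a, b)` maximal, `a ≠ 0` and `b c = a d`: `z := c/a` lies in `Ā_P` (step c-1) and in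
`A[1/f]·(A′∖P)⁻¹` for every `f ∈ s` (step c-2), hence `t · z ∈ Ā ∩ ⋂ A[1/f] = A′` for a product `t` of elements of `A′ ∖ P`.
Hypotheses: `A` Noetherian of dimension `≤ 2`, `Ā` finite over `A`, and the maximal ideals of `Ā` have height `dim A`
(equidimensionality of the affine domain `Ā` — discharged from finite type over a field in `…_of_finiteType`).
[folklore; cite: EGAIV2, 5.10.16–17] -/
theorem div_mem_locSub [IsNoetherianRing A] (hdimA : ringKrullDim A ≤ 2) (hfin : Module.Finite A (integralClosure A K))
    (hequi : ∀ Q : Ideal (integralClosure A K), Q.IsMaximal → (Q.height : WithBot ℕ∞) = ringKrullDim A)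
    (hP : ∀ (f : A), f ∈ s → algebraMap A (s2Mod A K s hs) f ∈ P)
    (hd : ringKrullDim (locSub A K s hs P) = (2 : ℕ))
    {a b c d : locSub A K s hs P} (hrel : b * c = a * d) (ha : a ≠ 0)
    (hrad : (Ideal.span {a, b}).radical.IsMaximal) : (c : K) / (a : K) ∈ locSub A K s hs P := by
  classical
  haveI := IsLocalization.AtPrime.isLocalRing (locSub A K s hs P) P
  haveI := isIntegral_s2Mod A K s hs
  -- `P·A′_P ⊆ √(a, b) = 𝔪`
  have hradEq : (Ideal.span {a, b}).radical = maximalIdeal (locSub A K s hs P) := IsLocalRing.eq_maximalIdeal hrad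
  have hPab : ∀ x ∈ P, algebraMap (s2Mod A K s hs) (locSub A K s hs P) x ∈ (Ideal.span {a, b}).radical := by
    intro x hx
    rw [hradEq]
    exact (IsLocalization.AtPrime.to_map_mem_maximal_iff (locSub A K s hs P) P x).mpr hx
  -- dimensions: `ht P = 2 ≤ dim A′ ≤ dim A ≤ 2`
  have hPht : (P.height : WithBot ℕ∞) = (2 : ℕ) := by
    rw [← IsLocalization.AtPrime.ringKrullDim_eq_height P (locSub A K s hs P), hd]
  have hBge : ((2 : ℕ) : WithBot ℕ∞) ≤ ringKrullDim (s2Mod A K s hs) := by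
    rw [← hPht]
    exact Ideal.height_le_ringKrullDim_of_isPrime
  have hBA : ringKrullDim (s2Mod A K s hs) ≤ ringKrullDim A :=
    Literature.RingTheory.KrullDimension.ringKrullDim_le_of_isIntegral
  have hdimA2 : ringKrullDim A = (2 : ℕ) := le_antisymm hdimA (hBge.trans hBA)
  have hdimB2 : ringKrullDim (s2Mod A K s hs) = (2 : ℕ) := le_antisymm (hBA.trans hdimA) hBge
  -- `P` is maximal
  haveI : FiniteRingKrullDim (s2Mod A K s hs) :=
    finiteRingKrullDim_iff_ne_bot_and_top.mpr ⟨by rw [hdimB2]; exact WithBot.coe_ne_bot, by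
      rw [hdimB2]; exact ne_of_beq_false rfl⟩
  have hPmax : P.IsMaximal := Ideal.isMaximal_of_height_eq_ringKrullDim (by rw [hPht, hdimB2])
  -- (c-1): `t₀ z ∈ Ā`
  obtain ⟨y, t₀, ht₀, hz⟩ := (mem_normLoc_iff A K s hs P _).mp
    (div_mem_normLoc A K s hs P hfin hequi hdimA2 hPmax hrel ha hPab)
  have ht₀K : (t₀ : K) ≠ 0 := coe_ne_zero_of_not_mem A K s hs P ht₀
  have hz₀ : (t₀ : K) * ((c : K) / (a : K)) ∈ integralClosure A K := by
    rw [hz, mul_comm, mul_assoc, inv_mul_cancel₀ ht₀K, mul_one]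
    exact y.2
  -- (c-2): `t_f z ∈ A[1/f]`
  have key : ∀ f : s, ∃ t : s2Mod A K s hs, t ∉ P ∧ (t : K) * ((c : K) / (a : K)) ∈ awaySub A K f.1 (hs f.1 f.2) :=
    fun f => exists_mul_div_mem_awaySub A K s hs P hrel ha hPab f.1 f.2 (hP f.1 f.2)
  choose tf htfP htf using key
  -- combine
  refine (mem_locSub_iff' A K s hs P _).mpr ⟨t₀ * ∏ f : s, tf f, ?_, ?_⟩
  · have h1 : (∏ f : s, tf f) ∈ P.primeCompl :=
      prod_mem (S := P.primeCompl) fun f _ => (Ideal.mem_primeCompl_iff.mpr (htfP f))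
    exact Ideal.mem_primeCompl_iff.mp (P.primeCompl.mul_mem (Ideal.mem_primeCompl_iff.mpr ht₀) h1)
  · rw [Subalgebra.coe_mul]
    show _ ∈ integralClosure A K ⊓ ⨅ f : s, awaySub A K f.1 (hs f.1 f.2)
    refine Algebra.mem_inf.mpr ⟨?_, Algebra.mem_iInf.mpr fun f => ?_⟩
    · rw [mul_comm ((t₀ : s2Mod A K s hs) : K), mul_assoc]
      exact Subalgebra.mul_mem _ (s2Mod_le_integralClosure A K s hs (∏ f : s, tf f).2) hz₀
    · rw [SubmonoidClass.coe_finsetProd,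
        ← Finset.mul_prod_erase Finset.univ (fun g : s => ((tf g : s2Mod A K s hs) : K)) (Finset.mem_univ f),
        mul_comm ((tf f : s2Mod A K s hs) : K), ← mul_assoc, mul_assoc]
      refine Subalgebra.mul_mem _ (Subalgebra.mul_mem _ (s2Mod_le_awaySub A K s hs f.1 f.2 t₀.2) ?_) (htf f)
      refine s2Mod_le_awaySub A K s hs f.1 f.2 ?_
      rw [← SubmonoidClass.coe_finsetProd]
      exact (∏ g ∈ Finset.univ.erase f, tf g).2

/-- `Set.range` of a pair `t : Fin 2 → R` is `{t 0, t 1}`. [folklore] -/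
theorem range_fin_two {R : Type} (t : Fin 2 → R) : Set.range t = {t 0, t 1} := by
  ext x
  simp only [Set.mem_range, Set.mem_insert_iff, Set.mem_singleton_iff]
  constructor
  · rintro ⟨i, rfl⟩
    fin_cases i
    · exact Or.inl rfl
    · exact Or.inr rfl
  · rintro (rfl | rfl)
    · exact ⟨0, rfl⟩
    · exact ⟨1, rfl⟩

/-- **THE COHEN–MACAULAY CLAUSE FOR `A′_P` IN DIMENSION 2** (memo §2 (c)): for a prime `P ⊇ s` of the S₂-modification algebra
`A′` with `dim A′_P = 2`, every system of parameters `a, b` of `A′_P` is a weakly regular sequence — `a ≠ 0` (Krull's principal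
ideal theorem: `√(b) = 𝔪` would force `ht 𝔪 ≤ 1`) and `b c ∈ (a) ⇒ c ∈ (a)` by `div_mem_locSub`. Hypotheses as there.
[folklore; cite: EGAIV2, 5.10.16–17] -/
theorem cmClause_locSub_of_eq_two [IsNoetherianRing A] (hdimA : ringKrullDim A ≤ 2)
    (hfin : Module.Finite A (integralClosure A K))
    (hequi : ∀ Q : Ideal (integralClosure A K), Q.IsMaximal → (Q.height : WithBot ℕ∞) = ringKrullDim A)
    (hP : ∀ (f : A), f ∈ s → algebraMap A (s2Mod A K s hs) f ∈ P)
    (hd : ringKrullDim (locSub A K s hs P) = (2 : ℕ)) : NonFullLocusClosed.CMClause (locSub A K s hs P) := by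
  classical
  haveI := IsLocalization.AtPrime.isLocalRing (locSub A K s hs P) P
  -- `A′_P` is Noetherian
  haveI : Module.Finite A (integralClosure A K) := hfin
  haveI : Module.Finite A (s2Mod A K s hs) :=
    Module.Finite.of_injective (Subalgebra.inclusion (s2Mod_le_integralClosure A K s hs)).toLinearMap
      (fun x y hxy => Subalgebra.inclusion_injective (s2Mod_le_integralClosure A K s hs) hxy)
  haveI : IsNoetherianRing (s2Mod A K s hs) := IsNoetherianRing.of_finite A _
  haveI : IsNoetherianRing (locSub A K s hs P) := IsLocalization.isNoetherianRing P.primeCompl _ inferInstance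
  intro n hn t ht
  have hn2 : n = 2 := by
    rw [hd] at hn
    exact_mod_cast hn.symm
  subst hn2
  rw [range_fin_two] at ht
  have hradEq : (Ideal.span {t 0, t 1}).radical = maximalIdeal (locSub A K s hs P) := IsLocalRing.eq_maximalIdeal ht
  -- `t 0 ≠ 0` by Krull's principal ideal theorem
  have ht0 : t 0 ≠ 0 := by
    intro h0
    rw [h0, Ideal.span_insert_zero] at hradEq
    have hmin : maximalIdeal (locSub A K s hs P) ∈ (Ideal.span {t 1}).minimalPrimes := by
      rw [← Ideal.radical_minimalPrimes, hradEq, Ideal.minimalPrimes_eq_subsingleton_self]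
      exact Set.mem_singleton _
    have h1 := Ideal.height_le_one_of_isPrincipal_of_mem_minimalPrimes (Ideal.span {t 1}) _ hmin
    have h2 := IsLocalRing.maximalIdeal_height_eq_ringKrullDim (R := locSub A K s hs P)
    rw [hd] at h2
    have h4 : ((maximalIdeal (locSub A K s hs P)).height : WithBot ℕ∞) ≤ ((1 : ℕ∞) : WithBot ℕ∞) :=
      WithBot.coe_le_coe.mpr h1
    rw [h2] at h4
    norm_num at h4
  rw [List.ofFn_succ, List.ofFn_succ, List.ofFn_zero]
  refine RingTheory.Sequence.IsWeaklyRegular.cons (isLeftRegular_iff.mp (IsRegular.of_ne_zero' ht0).left)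
    (RingTheory.Sequence.IsWeaklyRegular.cons ?_ (RingTheory.Sequence.IsWeaklyRegular.nil _ _))
  simp only [Fin.succ_zero_eq_one]
  apply Literature.AlgebraicGeometry.Resolution.isSMulRegular_quotSMulTop_of_forall
  intro y hy
  obtain ⟨d, hd'⟩ := Ideal.mem_span_singleton'.mp hy
  have hrel : t 1 * y = t 0 * d := by rw [← hd', mul_comm d]
  have hz := div_mem_locSub A K s hs P hdimA hfin hequi hP hd hrel ht0 ht
  have haK : ((t 0 : locSub A K s hs P) : K) ≠ 0 := fun h => ht0 (Subtype.ext h)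
  refine Ideal.mem_span_singleton'.mpr ⟨⟨(y : K) / ((t 0 : locSub A K s hs P) : K), hz⟩, Subtype.ext ?_⟩
  change (y : K) / ((t 0 : locSub A K s hs P) : K) * ((t 0 : locSub A K s hs P) : K) = (y : K)
  exact div_mul_cancel₀ _ haK

end DimTwo

end Summit.ResolutionOfSingularities.ResolutionOfSingularities.Theorems.FInjectiveMacaulayfication.S2ModificationAffineDimTwo

end
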